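import Summits.AtomisticToContinuum.Crystallization.Theorems.HolmgrenBoyleLindPatchHull
import Summits.AtomisticToContinuum.Crystallization.Theorems.HolmgrenBoyleLindHalfSpaceRigidityPeriodicLattice

/-!
# Route `HolmgrenBoyleLind`, item `FLCEquilibriumPeriodic`: the centrosymmetric class

Support file for item stmt-AtomisticToContinuum-6079 (`FLCEquilibriumPeriodic`: every
`δ`-separated, `r`-dense subset of `ℝ³` of finite local complexity in exact Lennard-Jones force
balance is the point set of a periodic configuration; equivalent to the crux
`HalfSpaceUniqueContinuation`, `flcEquilibriumPeriodic_iff_uc`).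

The only mechanism that puts an infinite point set in EXACT force balance without solving
infinitely many equations is site symmetry: if the stabiliser of `x` in the symmetry group of `Λ`
fixes no non-zero vector, the (absolutely convergent) force at `x` vanishes for every pair
potential.  The simplest and most common instance is inversion symmetry about every site
(`x + v ∈ Λ ↔ x - v ∈ Λ`), which covers every Bravais lattice.  This file settles the item on that
class and records that the hypothesis class of the item is not empty:

* `hbl_span_sub_eq_top` — the differences of a relatively dense subset of `ℝ³` span `ℝ³`;
* `hbl_period_of_centrosymmetric` — if `Λ` is centrosymmetric about each of its points, then
  `2 (y - x)` is a period of `Λ` for all `x, y ∈ Λ` (two point reflections compose to a translation);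
* `hbl_periodic_of_centrosymmetric` — hence a uniformly discrete, relatively dense `Λ ⊆ ℝ³`
  centrosymmetric about each of its points is the point set of a periodic configuration
  (`exists_periodicConfiguration_of_span_eq_top`): the centrosymmetric class contains NO aperiodic
  set at all, so no counterexample to `FLCEquilibriumPeriodic` (nor to the crux) can come from it;
* `hbl_map_tsum_ljForce_eq`, `hbl_balanced_of_site_symmetric` — site symmetry: a linear isometry
  `A` preserving `Λ` seen from `x` fixes the total force on `x` (re-indexing of the `tsum`), so a
  family of such isometries without common fixed vector puts `x` in exact force balance (covers
  Bravais lattices, `A = -1`, and e.g. hcp at any `c/a`, site group `D₃ₕ`);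
* `hbl_balanced_of_centrosymmetric` — a `δ`-separated `Λ` centrosymmetric about each of its points
  is in exact Lennard-Jones force balance (the case `A = -1`);
* `hbl_lattice_hypotheses` — every full-rank lattice `L ⊆ ℝ³` satisfies ALL hypotheses of
  `FLCEquilibriumPeriodic` (separation, relative density, finite local complexity, exact balance):
  the item is not vacuous.

All `[folklore]`; nothing here closes an item.
-/

noncomputable section

namespace Summit.AtomisticToContinuum.Crystallization.Theorems

open scoped BigOperators Topology InnerProductSpace
open Literature.MathematicalPhysics.StatisticalMechanics
open Summit.AtomisticToContinuum.Crystallization.Theorems.HolmgrenBoyleLind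

/-! ## Differences of a relatively dense set span -/

/-- The differences `y - x`, `x, y ∈ Λ`, of a relatively dense `Λ ⊆ ℝ³` span `ℝ³`: a normal vector
`u` to their span would make `y ↦ ⟪y, u⟫` constant on `Λ`, which relative density forbids.
[folklore] -/
theorem hbl_span_sub_eq_top {Λ : Set (EuclideanSpace ℝ (Fin 3))} {r : ℝ}
    (hden : ∀ c : EuclideanSpace ℝ (Fin 3), ∃ y ∈ Λ, dist y c ≤ r) :
    Submodule.span ℝ {t : EuclideanSpace ℝ (Fin 3) | ∃ x ∈ Λ, ∃ y ∈ Λ, t = y - x} = ⊤ := by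
  by_contra hne
  have hbot : (Submodule.span ℝ
      {t : EuclideanSpace ℝ (Fin 3) | ∃ x ∈ Λ, ∃ y ∈ Λ, t = y - x})ᗮ ≠ ⊥ := by
    rwa [Ne, Submodule.orthogonal_eq_bot_iff]
  obtain ⟨u, huK, hu0⟩ := (Submodule.ne_bot_iff _).1 hbot
  have horth : ∀ x ∈ Λ, ∀ y ∈ Λ, ⟪y - x, u⟫_ℝ = 0 := fun x hx y hy =>
    (Submodule.mem_orthogonal _ u).1 huK (y - x) (Submodule.subset_span ⟨x, hx, y, hy, rfl⟩)
  obtain ⟨x₀, hx₀, -⟩ := hden 0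
  have hu : 0 < ‖u‖ := norm_pos_iff.2 hu0
  -- a point of `Λ` far out in the direction `u`
  set c : EuclideanSpace ℝ (Fin 3) := x₀ + ((r * ‖u‖ + 1) / ‖u‖ ^ 2) • u with hc
  obtain ⟨y, hy, hyc⟩ := hden c
  have hcu : ⟪c - x₀, u⟫_ℝ = r * ‖u‖ + 1 := by
    rw [hc, add_sub_cancel_left, real_inner_smul_left, real_inner_self_eq_norm_sq]
    field_simp
  have hyx : ⟪y - x₀, u⟫_ℝ = 0 := horth x₀ hx₀ y hy
  have hdiff : |⟪y - c, u⟫_ℝ| ≤ r * ‖u‖ := by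
    calc |⟪y - c, u⟫_ℝ| ≤ ‖y - c‖ * ‖u‖ := abs_real_inner_le_norm _ _
      _ ≤ r * ‖u‖ := by
        gcongr
        rwa [← dist_eq_norm]
  have e : ⟪y - c, u⟫_ℝ = ⟪y - x₀, u⟫_ℝ - ⟪c - x₀, u⟫_ℝ := by
    rw [← inner_sub_left]
    congr 1
    abel
  rw [e, hyx, hcu, zero_sub, abs_neg] at hdiff
  have h2 : r * ‖u‖ + 1 ≤ |r * ‖u‖ + 1| := le_abs_self _
  linarith

/-! ## Centrosymmetric sets are periodic -/

/-- **Two point reflections compose to a translation.** If `Λ` is centrosymmetric about each of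
its points (`x + v ∈ Λ ↔ x - v ∈ Λ` for `x ∈ Λ`), then `2 (y - x)` is a period of `Λ` for all
`x, y ∈ Λ`. [folklore] -/
theorem hbl_period_of_centrosymmetric {Λ : Set (EuclideanSpace ℝ (Fin 3))}
    (hcs : ∀ x ∈ Λ, ∀ v : EuclideanSpace ℝ (Fin 3), x + v ∈ Λ ↔ x - v ∈ Λ)
    {x y : EuclideanSpace ℝ (Fin 3)} (hx : x ∈ Λ) (hy : y ∈ Λ) :
    ∀ z : EuclideanSpace ℝ (Fin 3), z + (2 : ℝ) • (y - x) ∈ Λ ↔ z ∈ Λ := by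
  intro z
  -- reflect about `x`: `z ∈ Λ ↔ 2x - z ∈ Λ`
  have h1 : z ∈ Λ ↔ x - (z - x) ∈ Λ := by
    have h := hcs x hx (z - x)
    rwa [add_sub_cancel] at h
  -- reflect about `y`: `2y - (2x - z) ∈ Λ ↔ 2x - z ∈ Λ`
  have h2 : y + (y - (x - (z - x))) ∈ Λ ↔ y - (y - (x - (z - x))) ∈ Λ := hcs y hy _
  have e1 : z + (2 : ℝ) • (y - x) = y + (y - (x - (z - x))) := by
    rw [two_smul]
    abel
  have e2 : y - (y - (x - (z - x))) = x - (z - x) := by abel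
  rw [e1, h2, e2]
  exact h1.symm

/-- **Centrosymmetric Delone sets are crystals.** A uniformly discrete, relatively dense
`Λ ⊆ ℝ³` that is centrosymmetric about each of its points is the point set of a periodic
configuration: its periods contain `2 (Λ - Λ)`, which spans `ℝ³` (`hbl_span_sub_eq_top`), and a
uniformly discrete set with spanning periods is `F + G` (`exists_periodicConfiguration_of_span_eq_top`,
Baake–Grimm 2013 Prop. 3.1). In particular the centrosymmetric class — where Lennard-Jones force
balance is automatic, `hbl_balanced_of_centrosymmetric` — contains no aperiodic set, hence no
counterexample to `FLCEquilibriumPeriodic`. [folklore] -/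
theorem hbl_periodic_of_centrosymmetric {Λ : Set (EuclideanSpace ℝ (Fin 3))} {δ r : ℝ}
    (hδ : 0 < δ) (hsep : ∀ x ∈ Λ, ∀ y ∈ Λ, x ≠ y → δ ≤ dist x y)
    (hden : ∀ c : EuclideanSpace ℝ (Fin 3), ∃ y ∈ Λ, dist y c ≤ r)
    (hcs : ∀ x ∈ Λ, ∀ v : EuclideanSpace ℝ (Fin 3), x + v ∈ Λ ↔ x - v ∈ Λ) :
    ∃ P : PeriodicConfiguration 3, P.points = Λ := by
  refine exists_periodicConfiguration_of_span_eq_top hδ hsep hden ?_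
  rw [eq_top_iff, ← hbl_span_sub_eq_top hden]
  refine Submodule.span_le.2 ?_
  rintro t ⟨x, hx, y, hy, rfl⟩
  have hp : (2 : ℝ) • (y - x) ∈
      {t : EuclideanSpace ℝ (Fin 3) | ∀ z : EuclideanSpace ℝ (Fin 3), z + t ∈ Λ ↔ z ∈ Λ} :=
    hbl_period_of_centrosymmetric hcs hx hy
  have e : y - x = (1 / 2 : ℝ) • ((2 : ℝ) • (y - x)) := by
    rw [smul_smul]
    norm_num
  rw [e]
  exact Submodule.smul_mem _ _ (Submodule.subset_span hp)

/-! ## Site symmetry gives exact Lennard-Jones force balance -/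

/-- **Site symmetry transports the force.** If the linear isometry `A` preserves `Λ ⊆ ℝ³` seen
from `x` (`x + A v ∈ Λ ↔ x + v ∈ Λ`), then the total Lennard-Jones force `S` on `x` (the `tsum` of
the pair forces over `Λ ∖ {x}`; absolutely convergent when `Λ` is separated,
`hbl_summable_norm_ljForce`) satisfies `A S = S`: re-index the sum by `y ↦ x + A (y - x)`. No
separation hypothesis is needed for the identity itself. [folklore] -/
theorem hbl_map_tsum_ljForce_eq {Λ : Set (EuclideanSpace ℝ (Fin 3))}
    {x : EuclideanSpace ℝ (Fin 3)}
    (A : EuclideanSpace ℝ (Fin 3) ≃ₗᵢ[ℝ] EuclideanSpace ℝ (Fin 3))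
    (hA : ∀ v : EuclideanSpace ℝ (Fin 3), x + A v ∈ Λ ↔ x + v ∈ Λ) :
    A (∑' y : {y : EuclideanSpace ℝ (Fin 3) // y ∈ Λ ∧ y ≠ x},
        (deriv lennardJones (dist x (y : EuclideanSpace ℝ (Fin 3))) /
          dist x (y : EuclideanSpace ℝ (Fin 3))) • (x - (y : EuclideanSpace ℝ (Fin 3)))) =
      ∑' y : {y : EuclideanSpace ℝ (Fin 3) // y ∈ Λ ∧ y ≠ x},
        (deriv lennardJones (dist x (y : EuclideanSpace ℝ (Fin 3))) /
          dist x (y : EuclideanSpace ℝ (Fin 3))) • (x - (y : EuclideanSpace ℝ (Fin 3))) := by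
  set f : {y : EuclideanSpace ℝ (Fin 3) // y ∈ Λ ∧ y ≠ x} → EuclideanSpace ℝ (Fin 3) :=
    fun y => (deriv lennardJones (dist x (y : EuclideanSpace ℝ (Fin 3))) /
      dist x (y : EuclideanSpace ℝ (Fin 3))) • (x - (y : EuclideanSpace ℝ (Fin 3))) with hf
  -- re-indexing by an isometry `B` that preserves `Λ` seen from `x`
  have hmem : ∀ B : EuclideanSpace ℝ (Fin 3) ≃ₗᵢ[ℝ] EuclideanSpace ℝ (Fin 3),
      (∀ v : EuclideanSpace ℝ (Fin 3), x + B v ∈ Λ ↔ x + v ∈ Λ) →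
      ∀ y : {y : EuclideanSpace ℝ (Fin 3) // y ∈ Λ ∧ y ≠ x},
        x + B ((y : EuclideanSpace ℝ (Fin 3)) - x) ∈ Λ ∧
          x + B ((y : EuclideanSpace ℝ (Fin 3)) - x) ≠ x := by
    intro B hB y
    refine ⟨(hB _).2 (by rw [add_sub_cancel]; exact y.2.1), ?_⟩
    intro h
    have h1 : B ((y : EuclideanSpace ℝ (Fin 3)) - x) = 0 := by
      have h' := congrArg (fun w => w - x) h
      simpa using h'
    have h2 : (y : EuclideanSpace ℝ (Fin 3)) - x = 0 :=
      B.injective (by rw [h1, map_zero])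
    exact y.2.2 (sub_eq_zero.1 h2)
  have hA' : ∀ v : EuclideanSpace ℝ (Fin 3), x + A.symm v ∈ Λ ↔ x + v ∈ Λ := by
    intro v
    have h := hA (A.symm v)
    rw [LinearIsometryEquiv.apply_symm_apply] at h
    exact h.symm
  let e : {y : EuclideanSpace ℝ (Fin 3) // y ∈ Λ ∧ y ≠ x} ≃
      {y : EuclideanSpace ℝ (Fin 3) // y ∈ Λ ∧ y ≠ x} :=
    { toFun := fun y => ⟨x + A ((y : EuclideanSpace ℝ (Fin 3)) - x), hmem A hA y⟩
      invFun := fun y => ⟨x + A.symm ((y : EuclideanSpace ℝ (Fin 3)) - x), hmem A.symm hA' y⟩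
      left_inv := fun y => Subtype.ext (by simp)
      right_inv := fun y => Subtype.ext (by simp) }
  have hfe : ∀ y, f (e y) = A (f y) := by
    intro y
    show (deriv lennardJones (dist x (x + A ((y : EuclideanSpace ℝ (Fin 3)) - x))) /
        dist x (x + A ((y : EuclideanSpace ℝ (Fin 3)) - x))) •
        (x - (x + A ((y : EuclideanSpace ℝ (Fin 3)) - x))) = A (f y)
    have hd : dist x (x + A ((y : EuclideanSpace ℝ (Fin 3)) - x)) =
        dist x (y : EuclideanSpace ℝ (Fin 3)) := by
      rw [dist_eq_norm, dist_eq_norm, sub_add_cancel_left, norm_neg, LinearIsometryEquiv.norm_map,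
        ← norm_neg, neg_sub]
    have hv : x - (x + A ((y : EuclideanSpace ℝ (Fin 3)) - x)) =
        A (x - (y : EuclideanSpace ℝ (Fin 3))) := by
      rw [sub_add_cancel_left, ← map_neg A, neg_sub]
    rw [hd, hv, hf, LinearIsometryEquiv.map_smul]
  calc A (∑' y, f y) = ∑' y, A (f y) := by
        show A.toContinuousLinearEquiv (∑' y, f y) = ∑' y, A.toContinuousLinearEquiv (f y)
        exact A.toContinuousLinearEquiv.map_tsum
    _ = ∑' y, f (e y) := by simp_rw [hfe]
    _ = ∑' y, f y := Equiv.tsum_eq e f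

/-- **Site symmetry gives exact force balance.** If `Λ ⊆ ℝ³` is `δ`-separated and a family of
linear isometries `A i`, each preserving `Λ` seen from `x ∈ Λ`, has no common fixed vector but `0`,
then `x` is in exact Lennard-Jones force balance: the force is fixed by every `A i`
(`hbl_map_tsum_ljForce_eq`). This is the only potential-independent mechanism for balance; it
covers every Bravais lattice (`A = -1`) and e.g. the hexagonal close packing at any `c/a` (site
group `D₃ₕ`). [folklore] -/
theorem hbl_balanced_of_site_symmetric {Λ : Set (EuclideanSpace ℝ (Fin 3))} {δ : ℝ}
    (hδ : 0 < δ) (hsep : ∀ x ∈ Λ, ∀ y ∈ Λ, x ≠ y → δ ≤ dist x y)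
    {x : EuclideanSpace ℝ (Fin 3)} (hx : x ∈ Λ) {ι : Type*}
    (A : ι → EuclideanSpace ℝ (Fin 3) ≃ₗᵢ[ℝ] EuclideanSpace ℝ (Fin 3))
    (hA : ∀ i, ∀ v : EuclideanSpace ℝ (Fin 3), x + A i v ∈ Λ ↔ x + v ∈ Λ)
    (hfix : ∀ w : EuclideanSpace ℝ (Fin 3), (∀ i, A i w = w) → w = 0) :
    HasSum (fun y : {y : EuclideanSpace ℝ (Fin 3) // y ∈ Λ ∧ y ≠ x} =>
      (deriv lennardJones (dist x (y : EuclideanSpace ℝ (Fin 3))) /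
        dist x (y : EuclideanSpace ℝ (Fin 3))) • (x - (y : EuclideanSpace ℝ (Fin 3)))) 0 := by
  have hs := (hbl_summable_norm_ljForce hδ hsep hx).of_norm
  have h0 := hfix _ fun i => hbl_map_tsum_ljForce_eq (A i) (hA i)
  rw [← h0]
  exact hs.hasSum

/-- **Inversion symmetry gives exact force balance.** If `Λ ⊆ ℝ³` is `δ`-separated and
centrosymmetric about each of its points, then every `x ∈ Λ` is in exact Lennard-Jones force
balance (`hbl_balanced_of_site_symmetric` with the single isometry `-1`, which fixes only `0`).
[folklore] -/
theorem hbl_balanced_of_centrosymmetric {Λ : Set (EuclideanSpace ℝ (Fin 3))} {δ : ℝ}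
    (hδ : 0 < δ) (hsep : ∀ x ∈ Λ, ∀ y ∈ Λ, x ≠ y → δ ≤ dist x y)
    (hcs : ∀ x ∈ Λ, ∀ v : EuclideanSpace ℝ (Fin 3), x + v ∈ Λ ↔ x - v ∈ Λ) :
    ∀ x ∈ Λ, HasSum (fun y : {y : EuclideanSpace ℝ (Fin 3) // y ∈ Λ ∧ y ≠ x} =>
      (deriv lennardJones (dist x (y : EuclideanSpace ℝ (Fin 3))) /
        dist x (y : EuclideanSpace ℝ (Fin 3))) • (x - (y : EuclideanSpace ℝ (Fin 3)))) 0 := by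
  intro x hx
  refine hbl_balanced_of_site_symmetric hδ hsep hx (ι := Unit)
    (fun _ => LinearIsometryEquiv.neg ℝ) (fun _ v => ?_) (fun w hw => ?_)
  · show x + -v ∈ Λ ↔ x + v ∈ Λ
    rw [← sub_eq_add_neg]
    exact (hcs x hx v).symm
  · have h : -w = w := hw ()
    have h2 : (2 : ℝ) • w = 0 := by
      rw [two_smul]
      nth_rewrite 1 [← h]
      exact neg_add_cancel w
    rcases smul_eq_zero.1 h2 with h3 | h3
    · norm_num at h3
    · exact h3

/-! ## Non-vacuity: lattices satisfy every hypothesis of the item -/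

/-- **Bravais lattices satisfy the hypotheses of `FLCEquilibriumPeriodic`.** A full-rank lattice
`L ⊆ ℝ³` (discrete `ℤ`-submodule spanning `ℝ³`) is uniformly discrete, relatively dense (covering
radius of a `ℤ`-basis), of finite local complexity (all its `R`-patches coincide) and in exact
Lennard-Jones force balance (it is centrosymmetric about each of its points,
`hbl_balanced_of_centrosymmetric`). So the hypothesis class of item 6079 is non-empty, and on its
centrosymmetric part the conclusion holds (`hbl_periodic_of_centrosymmetric`). [folklore] -/
theorem hbl_lattice_hypotheses (L : Submodule ℤ (EuclideanSpace ℝ (Fin 3)))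
    [DiscreteTopology L] [IsZLattice ℝ L] :
    ∃ δ r : ℝ, 0 < δ ∧ 0 < r ∧
      (∀ x ∈ (L : Set (EuclideanSpace ℝ (Fin 3))), ∀ y ∈ (L : Set (EuclideanSpace ℝ (Fin 3))),
        x ≠ y → δ ≤ dist x y) ∧
      (∀ c : EuclideanSpace ℝ (Fin 3), ∃ y ∈ (L : Set (EuclideanSpace ℝ (Fin 3))), dist y c ≤ r) ∧
      (∀ R : ℝ, Set.Finite {S : Set (EuclideanSpace ℝ (Fin 3)) |
        ∃ x ∈ (L : Set (EuclideanSpace ℝ (Fin 3))),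
          S = {v : EuclideanSpace ℝ (Fin 3) | x + v ∈ (L : Set (EuclideanSpace ℝ (Fin 3))) ∧ ‖v‖ ≤ R}}) ∧
      (∀ x ∈ (L : Set (EuclideanSpace ℝ (Fin 3))),
        HasSum (fun y : {y : EuclideanSpace ℝ (Fin 3) //
            y ∈ (L : Set (EuclideanSpace ℝ (Fin 3))) ∧ y ≠ x} =>
          (deriv lennardJones (dist x (y : EuclideanSpace ℝ (Fin 3))) /
            dist x (y : EuclideanSpace ℝ (Fin 3))) • (x - (y : EuclideanSpace ℝ (Fin 3)))) 0) := by
  classical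
  -- uniform discreteness from the discrete topology of `L`
  obtain ⟨ε, hε, hball⟩ := Metric.isOpen_iff.1 (isOpen_discrete ({0} : Set L)) 0 rfl
  have hεL : ∀ g ∈ L, g ≠ 0 → ε ≤ ‖g‖ := by
    intro g hg hg0
    by_contra hlt
    rw [not_le] at hlt
    have hmem : (⟨g, hg⟩ : L) ∈ Metric.ball (0 : L) ε := by
      rw [Metric.mem_ball, Subtype.dist_eq]
      show dist g 0 < ε
      rwa [dist_zero_right]
    have h := hball hmem
    rw [Set.mem_singleton_iff, Subtype.ext_iff] at h
    exact hg0 h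
  have hsep : ∀ x ∈ (L : Set (EuclideanSpace ℝ (Fin 3))), ∀ y ∈ (L : Set (EuclideanSpace ℝ (Fin 3))),
      x ≠ y → ε ≤ dist x y := by
    intro x hx y hy hxy
    rw [dist_eq_norm]
    exact hεL (x - y) (L.sub_mem hx hy) (sub_ne_zero.2 hxy)
  -- centrosymmetry about each lattice point
  have hcs : ∀ x ∈ (L : Set (EuclideanSpace ℝ (Fin 3))), ∀ v : EuclideanSpace ℝ (Fin 3),
      x + v ∈ (L : Set (EuclideanSpace ℝ (Fin 3))) ↔ x - v ∈ (L : Set (EuclideanSpace ℝ (Fin 3))) := by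
    intro x hx v
    simp only [SetLike.mem_coe] at hx ⊢
    constructor
    · intro h
      have hv : v ∈ L := by simpa using L.sub_mem h hx
      exact L.sub_mem hx hv
    · intro h
      have hv : v ∈ L := by simpa using L.sub_mem hx h
      exact L.add_mem hx hv
  -- relative density: the covering radius of a `ℤ`-basis
  let b₀ := Module.Free.chooseBasis ℤ L
  let b := b₀.ofZLatticeBasis ℝ L
  set ρ : ℝ := ∑ i, ‖b i‖ with hρ
  have hden : ∀ c : EuclideanSpace ℝ (Fin 3), ∃ y ∈ (L : Set (EuclideanSpace ℝ (Fin 3))),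
      dist y c ≤ max ρ 1 := by
    intro c
    refine ⟨(ZSpan.floor b c : EuclideanSpace ℝ (Fin 3)), ?_, ?_⟩
    · exact (b₀.ofZLatticeBasis_span ℝ).le (ZSpan.floor b c).2
    · rw [dist_comm, dist_eq_norm]
      have h := ZSpan.norm_fract_le b c
      rw [ZSpan.fract_apply] at h
      exact h.trans (le_max_left _ _)
  refine ⟨ε, max ρ 1, hε, lt_of_lt_of_le one_pos (le_max_right _ _), hsep, hden, ?_,
    hbl_balanced_of_centrosymmetric hε hsep hcs⟩
  -- finite local complexity: a single `R`-patch
  intro R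
  refine (Set.finite_singleton {v : EuclideanSpace ℝ (Fin 3) |
    v ∈ (L : Set (EuclideanSpace ℝ (Fin 3))) ∧ ‖v‖ ≤ R}).subset ?_
  rintro S ⟨x, hx, rfl⟩
  rw [Set.mem_singleton_iff]
  ext v
  simp only [Set.mem_setOf_eq, SetLike.mem_coe]
  simp only [SetLike.mem_coe] at hx
  constructor
  · rintro ⟨h, hv⟩
    exact ⟨by simpa using L.sub_mem h hx, hv⟩
  · rintro ⟨h, hv⟩
    exact ⟨L.add_mem hx h, hv⟩

end Summit.AtomisticToContinuum.Crystallization.Theorems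

end
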